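import Literature.NumberTheory.Automorphic.HeckeFamilyTraceSquareDefect
import Literature.NumberTheory.EllipticCurves.TakahashiRankOneOfTraceFormula
import HarnessLib

/-!
# Takahashi's `rank_ℤ L = 1` granting only the Eichler–Selberg trace formula
# (the mass formula is a consequence of the trace comparison)

Topic `NumberTheory/EllipticCurves`; theorems only (no named fact, no `sorry`).  In
`TakahashiRankOneOfTraceFormula.lean` the named fact `takahashi2001_brandtEigenLattice_rank_one`
(Takahashi 2001, p. 78: the `a(W)`-eigen-lattice of the Brandt matrices of an Eichler order of
level `M` in the definite quaternion algebra of prime discriminant `r`, `Mr` the conductor, is free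
of rank one) was derived from TWO named facts: the Eichler–Selberg trace formula
`HeckeTraceFormulaGL2Level N 𝟙 2` and Eichler's mass formula `brandtModule_massFormula`.  Here the
second is REMOVED.  Eichler's trace formula for the Brandt matrices is a theorem of the tree with
the mass term `μ_S = Σᵢ 1/wᵢ` left symbolic (`XiSetup.trace_matrix_eq_mass_add_sum`; restated in
Eichler–Selberg organisation as `XiSetup.trace_matrix_eq_sumInvWeight_add`), so the comparison
with the Eichler–Selberg formula at the levels `Mr`, `M` gives Pizer's trace identity (2.8) up to a
defect `δ(n = □) · c₀`, `c₀ = (r - 1)ψ(M)/12 - μ_S`, between the traces of the semisimple Hecke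
families `S₂(Mr) ⊕ ℂ_{σ₁}` and `ℂ^{Cls O} ⊕ S₂(M)²`; by
`eq_zero_of_trace_eq_trace_add_indicator_isSquare` such a defect vanishes.  Hence, granting the
Eichler–Selberg trace formula in weight `2` with trivial character:

* `sumInvWeight_eq_and_traceIdentity_of_traceFormula` — **the mass formula
  `Σᵢ 1/wᵢ = (r - 1)ψ(M)/12` AND the trace identity (2.8)** for every Brandt setup of type
  `(M, r)`, `r` prime, `r ∤ M`, `M` squarefree (`XiSetup.sum_inv_weight_eq_of_traceFormula`,
  `traceIdentity_of_traceFormula`);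
* `BrandtJL.nonempty_eichlerPizerIso_of_traceFormula` — Pizer's Thm. 2.28;
* `takahashi2001_brandtEigenLattice_rank_one_of_traceFormula` — **the named fact
  `takahashi2001_brandtEigenLattice_rank_one` from `∀ N, HeckeTraceFormulaGL2Level N 𝟙 2` alone**;
  `…_of_traceFormula_squarefree` — from the fact at squarefree levels only;
  `…_of_cuspidalHeckeTrace_eq` — from the bare identities
  `cuspidalHeckeTrace N 2 𝟙 n = geometricSide N 𝟙 2 n` for `N` squarefree and `(n, N) = 1`
  (the weakest `GL₂` input; `sumInvWeight_eq_and_traceIdentity_of_cuspidalHeckeTrace_eq`).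

## References

* [Takahashi2001] S. Takahashi, J. Number Theory 90 (2001), §2 p. 78.
* [Pizer1980] A. Pizer, J. Algebra 64 (1980), Thm. 2.25 (2.8), Thm. 2.28 and its proof (p. 360).
* [Eichler1955] M. Eichler, J. reine angew. Math. 195 (1955), (5) and §8 (trace formula for
  Brandt matrices; the mass formula as the `n = □` term).
* [VignerasLNM800] M.-F. Vignéras, LNM 800, Ch. V Prop. 2.4, Cor. 2.3 (mass formula).
-/

noncomputable section

open scoped MatrixGroups ModularForm ArithmeticFunction.sigma
open CongruenceSubgroup ArithmeticFunction

namespace Literature.NumberTheory.EllipticCurves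

open Literature.NumberTheory.Automorphic Literature.NumberTheory.Automorphic.Brandt
open Literature.NumberTheory.Automorphic.HeckeTraceFormulaGL2Level
open Literature.NumberTheory.EllipticCurves.ModularForms
open BrandtJL

/-! ### Eichler's trace formula for `tr B(n; p, M)` with the mass term left symbolic -/

/-- **Eichler's trace formula for the Brandt matrices of a setup of level `(M, p)`, `M`
squarefree, in Eichler–Selberg organisation, with the mass term `Σᵢ 1/wᵢ` left as it is**
(unconditional): for `n ≥ 1` prime to `Mp`,
`tr B(n) = δ(n = □) Σᵢ 1/wᵢ + ½ Σ_{t² < 4n} Σ_f h_w((t² - 4n)/f²) μ_M(t,f,n)(2 - μ_p(t,f,n))`.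
(Dot-notation extension of `Brandt.XiSetup`, declared with its absolute name.) [cite: Eichler1955, §8; VignerasLNM800, Ch. V §2 Prop. 2.4] -/
theorem _root_.Literature.NumberTheory.Automorphic.Brandt.XiSetup.trace_matrix_eq_sumInvWeight_add
    {M p : ℕ} (S : XiSetup M p) [Fintype (ClassSet S.O)] [NeZero M]
    (hsq : Squarefree M) (hp : p.Prime) (hpM : ¬ p ∣ M) (n : ℕ) (hn0 : 0 < n) (hn : n.Coprime (M * p)) :
    (((Brandt.matrix S.O n).trace : ℤ) : ℂ) =
      (if IsSquare n then ∑ i, (1 : ℂ) / (weight S.O i : ℂ) else 0) +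
        (1 / 2 : ℂ) *
          ∑ t ∈ (Finset.Icc (-(2 * n : ℤ)) (2 * n)).filter (fun t : ℤ => t ^ 2 < 4 * (n : ℤ)),
            ∑ f ∈ ellipticConductors t n,
              (weightedClassNumber ((t ^ 2 - 4 * n) / (f : ℤ) ^ 2) : ℂ) *
                (localDensity M 1 t f n * (2 - localDensity p 1 t f n)) := by
  have hQ := S.trace_matrix_eq_mass_add_sum hn0.ne'
  have hQC := congrArg (fun x : ℚ => (x : ℂ)) hQ
  beta_reduce at hQC
  push_cast at hQC
  rw [hQC, Finset.mul_sum]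
  congr 1
  · split_ifs <;> push_cast <;> ring
  · refine Finset.sum_congr rfl fun t ht => ?_
    rw [Finset.mem_filter] at ht
    have := S.ellipticTerm_eq hsq hp hpM hn ht.2
    push_cast at this
    exact this

/-! ### The trace comparison: the defect `δ(n = □) c₀` vanishes -/

section Comparison

variable {M p : ℕ} [NeZero M] [NeZero (M * p)]

/-- **Mass formula and trace identity from the Eichler–Selberg trace formula at the levels `Mp`,
`M`, weight `2`, trivial character, for the `n` prime to `Mp` only** (the weakest form of the
`GL₂` input: the identities `Tr(T_n | S₂(Γ₀(Mp))) = A₁ + A₂ + A₃ + A₄` and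
`Tr(T_n | S₂(Γ₀(M))) = A₁ + A₂ + A₃ + A₄` of the tree's `HeckeTraceFormulaGL2Level` for
`(n, Mp) = 1`).  For `p` prime, `p ∤ M`, `M` squarefree and a Brandt setup `S` of type `(M, p)`
they imply BOTH Eichler's mass formula `Σᵢ 1/wᵢ = (p - 1)ψ(M)/12` and the trace identity
`tr_{Mp} T(n) = tr B(n) - σ₁(n) + 2 tr_M T(n)` for all `n ≥ 1` prime to `Mp`: the two trace
formulas give `tr(S₂(Mp) ⊕ ℂ_{σ₁})(n) = tr(ℂ^{Cls O} ⊕ S₂(M)²)(n) + δ(n = □)((p-1)ψ(M)/12 - Σᵢ 1/wᵢ)`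
for two semisimple Hecke families with `c(q) = q`, and such a square-indicator defect vanishes
(`eq_zero_of_trace_eq_trace_add_indicator_isSquare`). [cite: Pizer1980, Thm. 2.25 (2.8) and its proof, p. 359; Eichler1955, (5)] -/
theorem sumInvWeight_eq_and_traceIdentity_of_cuspidalHeckeTrace_eq (hp : p.Prime) (hpM : ¬ p ∣ M)
    (hsq : Squarefree M) (S : XiSetup M p) [Fintype (ClassSet S.O)]
    (hES₁ : ∀ n : ℕ, 0 < n → n.Coprime (M * p) → cuspidalHeckeTrace (M * p) 2 1 n = geometricSide (M * p) 1 2 n)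
    (hES₂ : ∀ n : ℕ, 0 < n → n.Coprime (M * p) → cuspidalHeckeTrace M 2 1 n = geometricSide M 1 2 n) :
    (∑ i, (1 : ℂ) / (weight S.O i : ℂ)) = ((p : ℂ) - 1) * (dedekindPsi M : ℂ) / 12 ∧
      ∀ n : ℕ, 0 < n → n.Coprime (M * p) →
        cuspidalHeckeTrace (M * p) 2 1 n =
          (((Brandt.matrix S.O n).trace : ℤ) : ℂ) - ((σ 1 n : ℕ) : ℂ) + 2 * cuspidalHeckeTrace M 2 1 n := by
  classical
  set μ : ℂ := ∑ i, (1 : ℂ) / (weight S.O i : ℂ) with hμ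
  set c₀ : ℂ := ((p : ℂ) - 1) * (dedekindPsi M : ℂ) / 12 - μ with hc₀
  -- Step 1: the two trace formulas give the trace identity up to the defect `δ(n = □) c₀`
  have hdef : ∀ n : ℕ, 0 < n → n.Coprime (M * p) →
      cuspidalHeckeTrace (M * p) 2 1 n + ((σ 1 n : ℕ) : ℂ) =
        (((Brandt.matrix S.O n).trace : ℤ) : ℂ) + 2 * cuspidalHeckeTrace M 2 1 n +
          (if IsSquare n then c₀ else 0) := by
    intro n hn0 hn
    have h : cuspidalHeckeTrace (M * p) 2 1 n - 2 * cuspidalHeckeTrace M 2 1 n =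
        (if IsSquare n then ((p : ℂ) - 1) * (dedekindPsi M : ℂ) / 12 else 0) - ((σ 1 n : ℕ) : ℂ) -
          (1 / 2 : ℂ) *
            ∑ t ∈ (Finset.Icc (-(2 * n : ℤ)) (2 * n)).filter (fun t : ℤ => t ^ 2 < 4 * (n : ℤ)),
              ∑ f ∈ ellipticConductors t n,
                (weightedClassNumber ((t ^ 2 - 4 * n) / (f : ℤ) ^ 2) : ℂ) *
                  (localDensity M 1 t f n * (localDensity p 1 t f n - 2)) := by
      rw [hES₁ n hn0 hn, hES₂ n hn0 hn]
      exact geometricSide_one_two_mul_prime_sub hp hpM hn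
    have hBn := S.trace_matrix_eq_sumInvWeight_add hsq hp hpM n hn0 hn
    have hneg : (∑ t ∈ (Finset.Icc (-(2 * n : ℤ)) (2 * n)).filter (fun t : ℤ => t ^ 2 < 4 * (n : ℤ)),
        ∑ f ∈ ellipticConductors t n,
          (weightedClassNumber ((t ^ 2 - 4 * n) / (f : ℤ) ^ 2) : ℂ) *
            (localDensity M 1 t f n * (2 - localDensity p 1 t f n))) =
        -∑ t ∈ (Finset.Icc (-(2 * n : ℤ)) (2 * n)).filter (fun t : ℤ => t ^ 2 < 4 * (n : ℤ)),
          ∑ f ∈ ellipticConductors t n,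
            (weightedClassNumber ((t ^ 2 - 4 * n) / (f : ℤ) ^ 2) : ℂ) *
              (localDensity M 1 t f n * (localDensity p 1 t f n - 2)) := by
      rw [← Finset.sum_neg_distrib]
      refine Finset.sum_congr rfl fun t _ ↦ ?_
      rw [← Finset.sum_neg_distrib]
      refine Finset.sum_congr rfl fun f _ ↦ ?_
      ring
    rw [hneg, ← hμ] at hBn
    rw [hc₀]
    split_ifs at h hBn ⊢ with hsqn
    · linear_combination h - hBn
    · linear_combination h - hBn
  -- Step 2: the two semisimple Hecke families `S₂(Mp) ⊕ ℂ_{σ₁}` and `ℂ^{Cls O} ⊕ S₂(M)²`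
  haveI : FiniteDimensional ℂ (CuspForm (Gamma0 M) 2) := finiteDimensional_cuspForm_gamma0 M 2
  haveI : FiniteDimensional ℂ (CuspForm (Gamma0 (M * p)) 2) := finiteDimensional_cuspForm_gamma0 (M * p) 2
  have hMN : M ∣ M * p := dvd_mul_right M p
  set σ₁ : ℕ → ℂ := fun n => ((σ 1 n : ℕ) : ℂ) with hσ₁
  set TA : ℕ → Module.End ℂ (CuspForm (Gamma0 (M * p)) 2 × ℂ) :=
    fun n => (heckeTnGamma0 (M * p) 2 n).prodMap (scalarFamily ℂ σ₁ n) with hTA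
  set TB : ℕ → Module.End ℂ ((ClassSet S.O → ℂ) × (CuspForm (Gamma0 M) 2 × CuspForm (Gamma0 M) 2)) :=
    fun n => (S.heckeFamily n).prodMap ((heckeTnGamma0 M 2 n).prodMap (heckeTnGamma0 M 2 n)) with hTB
  have hM2 : IsHeckeFamily (M * p) (fun q => (q : ℂ)) (heckeTnGamma0 M 2) :=
    isHeckeFamily_of_dvd hMN (isHeckeFamily_heckeTnGamma0_two M)
  have hA : IsHeckeFamily (M * p) (fun q => (q : ℂ)) TA :=
    (isHeckeFamily_heckeTnGamma0_two (M * p)).prod (isHeckeFamily_sigmaOne ℂ (M * p))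
  have hB : IsHeckeFamily (M * p) (fun q => (q : ℂ)) TB := S.isHeckeFamily.prod (hM2.prod hM2)
  have hsM : IsSemisimpleFamily (M * p) (heckeTnGamma0 M 2) :=
    isSemisimpleFamily_of_dvd hMN (isSemisimpleFamily_heckeTnGamma0 M 2)
  have hsA : IsSemisimpleFamily (M * p) TA :=
    (isSemisimpleFamily_heckeTnGamma0 (M * p) 2).prod (isSemisimpleFamily_scalarFamily σ₁)
  have hsB : IsSemisimpleFamily (M * p) TB := S.isSemisimpleFamily.prod (hsM.prod hsM)
  have htr : ∀ n : ℕ, 0 < n → n.Coprime (M * p) →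
      LinearMap.trace ℂ _ (TA n) = LinearMap.trace ℂ _ (TB n) + if IsSquare n then c₀ else 0 := by
    intro n hn hnN
    rw [hTA, hTB]
    simp only [LinearMap.trace_prodMap', S.trace_heckeFamily, trace_heckeTnGamma0,
      trace_scalarFamily_complex]
    have := hdef n hn hnN
    linear_combination this
  -- Step 3: a prime `q ∤ Mp`; `c(q) = q ∉ {0, 1, -1}`; the defect vanishes
  obtain ⟨q, hqge, hq⟩ := Nat.exists_infinite_primes (M * p + 1)
  have hqN : ¬ q ∣ M * p := fun h => by
    have := Nat.le_of_dvd (Nat.pos_of_ne_zero (NeZero.ne _)) h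
    omega
  have hq0 : ((q : ℕ) : ℂ) ≠ 0 := by exact_mod_cast hq.ne_zero
  have hq1 : ((q : ℕ) : ℂ) ≠ 1 := by exact_mod_cast hq.one_lt.ne'
  have hq2 : ((q : ℕ) : ℂ) ≠ -1 := fun h => by
    have := congrArg Complex.re h
    simp only [Complex.natCast_re, Complex.neg_re, Complex.one_re] at this
    have h0 : (0 : ℝ) ≤ q := Nat.cast_nonneg q
    linarith
  have hc : c₀ = 0 :=
    eq_zero_of_trace_eq_trace_add_indicator_isSquare hA hB hsA hsB ⟨q, hq, hqN⟩ hq0 hq1 hq2 htr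
  -- conclusion
  refine ⟨?_, fun n hn0 hn => ?_⟩
  · rw [hc₀] at hc
    linear_combination -hc
  · have := hdef n hn0 hn
    rw [hc] at this
    simp only [ite_self, add_zero] at this
    linear_combination this

/-- `𝟙(-1) = (-1)²` for the trivial character (the parity condition of the trace formula in
weight `2`). [folklore] -/
theorem dirichletCharacter_one_neg_one_eq (N : ℕ) : (1 : DirichletCharacter ℂ N) (-1) = (-1 : ℂ) ^ (2 : ℤ) := by
  rw [MulChar.one_apply isUnit_one.neg, zpow_two]
  norm_num

/-- **Mass formula and trace identity from the Eichler–Selberg trace formula** (the tree's named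
fact `HeckeTraceFormulaGL2Level N 𝟙 2` at the levels `Mp` and `M`).  For `p` prime, `p ∤ M`, `M`
squarefree and a Brandt setup `S` of type `(M, p)`: Eichler's mass formula
`Σᵢ 1/wᵢ = (p - 1)ψ(M)/12` and the trace identity `tr_{Mp} T(n) = tr B(n) - σ₁(n) + 2 tr_M T(n)`
for all `n ≥ 1` prime to `Mp`. [cite: Pizer1980, Thm. 2.25 (2.8) and its proof, p. 359; Eichler1955, (5)] -/
theorem sumInvWeight_eq_and_traceIdentity_of_traceFormula (hp : p.Prime) (hpM : ¬ p ∣ M)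
    (hsq : Squarefree M) (S : XiSetup M p) [Fintype (ClassSet S.O)]
    (hTF₁ : HeckeTraceFormulaGL2Level (M * p) 1 2) (hTF₂ : HeckeTraceFormulaGL2Level M 1 2) :
    (∑ i, (1 : ℂ) / (weight S.O i : ℂ)) = ((p : ℂ) - 1) * (dedekindPsi M : ℂ) / 12 ∧
      ∀ n : ℕ, 0 < n → n.Coprime (M * p) →
        cuspidalHeckeTrace (M * p) 2 1 n =
          (((Brandt.matrix S.O n).trace : ℤ) : ℂ) - ((σ 1 n : ℕ) : ℂ) + 2 * cuspidalHeckeTrace M 2 1 n :=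
  sumInvWeight_eq_and_traceIdentity_of_cuspidalHeckeTrace_eq hp hpM hsq S
    (fun n hn0 _ => hTF₁ le_rfl (dirichletCharacter_one_neg_one_eq _) n hn0)
    (fun n hn0 _ => hTF₂ le_rfl (dirichletCharacter_one_neg_one_eq _) n hn0)

/-- **Eichler's mass formula from the Eichler–Selberg trace formula**: for a Brandt setup of type
`(M, p)` (`p` prime, `p ∤ M`, `M` squarefree), `Σᵢ 1/wᵢ = (p - 1) ψ(M)/12`. [cite: VignerasLNM800, Ch. V §2 Cor. 2.3; Eichler1955, (5)] -/
theorem _root_.Literature.NumberTheory.Automorphic.Brandt.XiSetup.sum_inv_weight_eq_of_traceFormula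
    (hp : p.Prime) (hpM : ¬ p ∣ M) (hsq : Squarefree M) (S : XiSetup M p) [Fintype (ClassSet S.O)]
    (hTF₁ : HeckeTraceFormulaGL2Level (M * p) 1 2) (hTF₂ : HeckeTraceFormulaGL2Level M 1 2) :
    ∑ i, (1 : ℚ) / weight S.O i = ((p : ℚ) - 1) * dedekindPsi M / 12 := by
  have h := (sumInvWeight_eq_and_traceIdentity_of_traceFormula hp hpM hsq S hTF₁ hTF₂).1
  have h' : (((∑ i, (1 : ℚ) / weight S.O i : ℚ)) : ℂ) = ((((p : ℚ) - 1) * dedekindPsi M / 12 : ℚ) : ℂ) := by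
    push_cast
    exact h
  exact_mod_cast h'

/-- **Eichler's trace identity (Pizer 1980 Thm. 2.25 (2.8), `r = 0`, `k = 2`) from the
Eichler–Selberg trace formula alone**: `tr_{Mp} T(n) = tr B(n) - σ₁(n) + 2 tr_M T(n)` for all
`n ≥ 1` prime to `Mp` (`p` prime, `p ∤ M`, `M` squarefree). [cite: Pizer1980, Thm. 2.25 (2.8), p. 359] -/
theorem traceIdentity_of_traceFormula (hp : p.Prime) (hpM : ¬ p ∣ M) (hsq : Squarefree M)
    (S : XiSetup M p) [Fintype (ClassSet S.O)]
    (hTF₁ : HeckeTraceFormulaGL2Level (M * p) 1 2) (hTF₂ : HeckeTraceFormulaGL2Level M 1 2) :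
    ∀ n : ℕ, 0 < n → n.Coprime (M * p) →
      cuspidalHeckeTrace (M * p) 2 1 n =
        (((Brandt.matrix S.O n).trace : ℤ) : ℂ) - ((σ 1 n : ℕ) : ℂ) + 2 * cuspidalHeckeTrace M 2 1 n :=
  (sumInvWeight_eq_and_traceIdentity_of_traceFormula hp hpM hsq S hTF₁ hTF₂).2

/-- **Eichler's trace identity from the trace-formula identities at the levels `Mp`, `M` for the
`n` prime to `Mp` only.** [cite: Pizer1980, Thm. 2.25 (2.8), p. 359] -/
theorem traceIdentity_of_cuspidalHeckeTrace_eq (hp : p.Prime) (hpM : ¬ p ∣ M) (hsq : Squarefree M)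
    (S : XiSetup M p) [Fintype (ClassSet S.O)]
    (hES₁ : ∀ n : ℕ, 0 < n → n.Coprime (M * p) → cuspidalHeckeTrace (M * p) 2 1 n = geometricSide (M * p) 1 2 n)
    (hES₂ : ∀ n : ℕ, 0 < n → n.Coprime (M * p) → cuspidalHeckeTrace M 2 1 n = geometricSide M 1 2 n) :
    ∀ n : ℕ, 0 < n → n.Coprime (M * p) →
      cuspidalHeckeTrace (M * p) 2 1 n =
        (((Brandt.matrix S.O n).trace : ℤ) : ℂ) - ((σ 1 n : ℕ) : ℂ) + 2 * cuspidalHeckeTrace M 2 1 n :=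
  (sumInvWeight_eq_and_traceIdentity_of_cuspidalHeckeTrace_eq hp hpM hsq S hES₁ hES₂).2

/-- **Pizer's Theorem 2.28 (Eichler's basis theorem in Hecke-module form) from the Eichler–Selberg
trace formula alone**: `(ℂ^{Cls O})⁰ ⊕ S₂(Γ₀(M))² ≅ S₂(Γ₀(Mr))` Hecke-equivariantly away from `Mr`,
for a Brandt setup of type `(M, r)`, `r` prime, `r ∤ M`, `M` squarefree. [cite: Pizer1980, Thm. 2.28] -/
theorem BrandtJL.nonempty_eichlerPizerIso_of_traceFormula {M r : ℕ} [NeZero M] [NeZero (M * r)]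
    (hr : r.Prime) (hrM : ¬ r ∣ M) (hsq : Squarefree M) (S : XiSetup M r) [Fintype (ClassSet S.O)]
    (hTF₁ : HeckeTraceFormulaGL2Level (M * r) 1 2) (hTF₂ : HeckeTraceFormulaGL2Level M 1 2) :
    Nonempty (EichlerPizerIso S) :=
  nonempty_eichlerPizerIso_of_traceIdentity S (traceIdentity_of_traceFormula hr hrM hsq S hTF₁ hTF₂)

end Comparison

/-- **Takahashi 2001, `rank_ℤ L = 1`, granting only the Eichler–Selberg trace formula** (weight
`2`, trivial character, all levels — the tree's named fact `HeckeTraceFormulaGL2Level N 𝟙 2`):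
Eichler's trace formula for Brandt matrices is a theorem of the tree with symbolic mass term, the
mass formula and the trace identity follow from the comparison
(`sumInvWeight_eq_and_traceIdentity_of_traceFormula`), and
`takahashi2001_brandtEigenLattice_rank_one_of_traceIdentity` applies. [cite: Takahashi2001, §2 p. 78; Pizer1980, Thm. 2.25 (2.8) and Thm. 2.28] -/
theorem takahashi2001_brandtEigenLattice_rank_one_of_traceFormula
    (hTF : ∀ (N : ℕ) [NeZero N], HeckeTraceFormulaGL2Level N 1 2) :
    takahashi2001_brandtEigenLattice_rank_one :=
  takahashi2001_brandtEigenLattice_rank_one_of_traceIdentity fun _ _ _ _ hr hsq S _ =>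
    traceIdentity_of_traceFormula hr (not_dvd_of_squarefree_mul hr hsq) (Squarefree.of_mul_left hsq) S
      (hTF _) (hTF _)

/-- **The same granting the Eichler–Selberg trace formula at SQUAREFREE levels only** (weight `2`,
trivial character): the levels that occur are `Mr` and `M` with `Mr` squarefree — Eichler's
original setting (J. reine angew. Math. 195 (1955); the trace formula for `T_n` on `S₂(Γ₀(N))`,
`N` squarefree, Eichler 1956/Selberg 1956). [cite: Takahashi2001, §2 p. 78; Pizer1980, Thm. 2.25 (2.8) and Thm. 2.28] -/
theorem takahashi2001_brandtEigenLattice_rank_one_of_traceFormula_squarefree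
    (hTF : ∀ (N : ℕ) [NeZero N], Squarefree N → HeckeTraceFormulaGL2Level N 1 2) :
    takahashi2001_brandtEigenLattice_rank_one :=
  takahashi2001_brandtEigenLattice_rank_one_of_traceIdentity fun _ _ _ _ hr hsq S _ =>
    traceIdentity_of_traceFormula hr (not_dvd_of_squarefree_mul hr hsq) (Squarefree.of_mul_left hsq) S
      (hTF _ hsq) (hTF _ (Squarefree.of_mul_left hsq))

/-- **The weakest `GL₂` input: `takahashi2001_brandtEigenLattice_rank_one` from the Eichler–Selberg
identities `Tr(T_n | S₂(Γ₀(N))) = A₁ + A₂ + A₃ + A₄` for squarefree `N`, weight `2`, trivial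
character and `(n, N) = 1` only** (the right-hand side being the tree's `geometricSide N 𝟙 2 n`).
[cite: Takahashi2001, §2 p. 78; Pizer1980, Thm. 2.25 (2.8) and Thm. 2.28] -/
theorem takahashi2001_brandtEigenLattice_rank_one_of_cuspidalHeckeTrace_eq
    (hES : ∀ (N : ℕ) [NeZero N], Squarefree N →
      ∀ n : ℕ, 0 < n → n.Coprime N → cuspidalHeckeTrace N 2 1 n = geometricSide N 1 2 n) :
    takahashi2001_brandtEigenLattice_rank_one :=
  takahashi2001_brandtEigenLattice_rank_one_of_traceIdentity fun M r _ _ hr hsq S _ =>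
    traceIdentity_of_cuspidalHeckeTrace_eq hr (not_dvd_of_squarefree_mul hr hsq) (Squarefree.of_mul_left hsq) S
      (fun n hn0 hn => hES (M * r) hsq n hn0 hn)
      (fun n hn0 hn => hES M (Squarefree.of_mul_left hsq) n hn0 (Nat.Coprime.coprime_dvd_right (dvd_mul_right M r) hn))

end Literature.NumberTheory.EllipticCurves

end
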